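import Mathlib
import HarnessLib
import Summits.HubbardSuperconductivity.HubbardSuperconductivity.Theorems.KLProgrammeKLRegimeEngineScaleZeroE4OverlapSpace
import Summits.HubbardSuperconductivity.HubbardSuperconductivity.Theorems.KLProgrammeKLRegimeEngineScaleZeroOverlapL1
import Summits.HubbardSuperconductivity.HubbardSuperconductivity.Theorems.KLProgrammeKLRegimeEngineScaleZeroExplicit

/-!
# KL programme (k = 3, c = 2, p1 g3) — ENGINE (E4)₀: `T_X`, the first SPACE moment of the scale-`0` sector multiplier torus sum,
# as a number `≤ C·M/β` (part 4: the export in the shape of the hypothesis `hT` of `firstMoment_zero_le_of_torusSums`)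

Helpers toward the item `KLRegimeEngineV16` (conjunct (E4)₀ of `stub_engine_scale0`).  The weighted multiplier torus sum `T_w` of
`firstMoment_zero_le_of_torusSums` splits as `T₀ + T_T + T_X` (weight `1 + (β/4M)·cyclicDist + torusSiteDist`); `T₀` is
`torusSum_le_of_symbol_bounds` (g2), `T_T` is p4's `exists_timeMomentConst_klAnisoFamily_zero`; this file delivers `T_X`:
the padded character sum of the multiplier is `βL²` times that of the padded piece of the full frame band
(`charSum_klAnisoFamily_zero_eq_padded`, via p4's `paddedPiece_last_eq_bgmGridSymbol`), `torusSiteDist ≤ |b̃₀| + |b̃₁|`, and the two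
directions are bounded by `spaceMoment_multiplier_padded_le` (part 3):

* **`spaceMoment_klAnisoFamily_zero_le`** —
  `(|β|L²)⁻¹·Σ_{(d,w)} torusSiteDist(w,0)·‖Σ_k F_ω(k)Χ_c(k;d,w)‖ ≤ (8M/β)·(C₀'(B,W_A) + C₁'(B)·W_A·36864·S⁴·((N_sc+1)U² + 2|U|))`.
-/

noncomputable section

namespace Summit.HubbardSuperconductivity.HubbardSuperconductivity.Theorems.EngineV8

set_option linter.dupNamespace false -- summit = problem name (single-conjunct summit), D-0017

open Real Finset Literature.MathematicalPhysics.QuantumLattice Literature.Probability.LatticeModels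
open Summit.HubbardSuperconductivity.HubbardSuperconductivity.Theorems.KLRegimeSplit
open Summit.HubbardSuperconductivity.HubbardSuperconductivity.Theorems.DispersionFlow
open Literature.MathematicalPhysics.QuantumLattice.FermiRG
open Summit.HubbardSuperconductivity.HubbardSuperconductivity.Theorems.KLProgrammeLegKernels
open scoped Nat ComplexConjugate

variable {L M : ℕ}

/-! ## §4 The export in the form of the weighted multiplier torus sum `hT` -/

/-- `torusSiteDist z 0 ≤ |z̃₀| + |z̃₁|`. -/
theorem torusSiteDist_zero_le_abs_add_abs [NeZero L] (z : TorusSite 2 L) :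
    torusSiteDist z 0 ≤ |(((z 0).valMinAbs : ℤ) : ℝ)| + |(((z 1).valMinAbs : ℤ) : ℝ)| := by
  have h := torusSiteDist_le_abs_add_abs z 0
  simpa only [sub_zero] using h

/-- **The padded character sum of the scale-`0` multiplier is `βL²` times that of the padded piece.** -/
theorem charSum_klAnisoFamily_zero_eq_padded [NeZero L] [NeZero M] {R : RenConsts} {U μ β : ℝ} {Nsc : ℕ} {K : TrigPolyC4v}
    (hK : FrameOK R U Nsc μ K) (hR : ∀ j, 0 ≤ R.Gfr j) (hμ : μ ∈ klWindowC) (hκU : 16 / 15 * (R.Gfr 0 * |U|) ≤ 1 / 50) (hβ : β ≠ 0)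
    (ω : Fin (sectorCount 0)) (d : TorusSite 1 (2 * (2 * M))) (w : TorusSite 2 L) :
    ∑ k : FreqMomentum L M, klAnisoFamily L M β μ K klE0 0 ω k *
        (torusChar (fun _ : Fin 1 => ((k.1 : ℕ) : ZMod (2 * (2 * M)))) d * torusChar k.2 w) =
      ((β * (L : ℝ) ^ 2 : ℝ) : ℂ) * ∑ q₀ : TorusSite 1 (2 * (2 * M)), ∑ qv : TorusSite 2 L, torusChar q₀ d * torusChar qv w *
        paddedPiece L M (2 * (2 * M)) β (fun ω' y => ((β * (L : ℝ) ^ 2 : ℝ) : ℂ) *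
              (((bgmCutoff₂ klE0 (fbPt ω' (frameLevel μ K (WithLp.toLp 2 (torusCentredMomentum L y)))) : ℝ) : ℂ) *
                ((zoneAngularRaw 1 (1 / 4) 0 ((ω : ℕ) : ℤ) (WithLp.toLp 2 (torusCentredMomentum L y)) : ℝ) : ℂ))) q₀ qv := by
  obtain ⟨Kp, hsum, -⟩ := hK.2
  have hL : (L : ℝ) ≠ 0 := by exact_mod_cast NeZero.ne L
  have hβL : ((β * (L : ℝ) ^ 2 : ℝ) : ℂ) ≠ 0 := by exact_mod_cast mul_ne_zero hβ (pow_ne_zero 2 hL)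
  rw [charSum_freqMomentum_eq_charSum_padded (fun ω k => klAnisoFamily L M β μ K klE0 0 ω k) ω d w,
    scaleZeroPadded_eq_bgmGridSymbol, Fintype.sum_prod_type, mul_sum]
  refine sum_congr rfl fun q₀ _ => ?_
  rw [mul_sum]
  refine sum_congr rfl fun qv _ => ?_
  have hp := paddedPiece_last_eq_bgmGridSymbol (L := L) (M := M) (N := 2 * (2 * M)) hK hR hsum hμ hκU hβ ω q₀ qv
  simp only [frameBandSeq_last_eq_frameLevel μ hsum] at hp
  have hunit : ((β * (L : ℝ) ^ 2 : ℝ) : ℂ) * (((1 / (β * (L : ℝ) ^ 2) : ℝ)) : ℂ) = 1 := by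
    rw [Complex.ofReal_div, Complex.ofReal_one, mul_one_div_cancel hβL]
  rw [smul_eq_mul]
  dsimp only
  calc torusChar q₀ d * torusChar qv w * bgmGridSymbol L M (2 * (2 * M)) klE0 β μ K ω q₀ qv
      = torusChar q₀ d * torusChar qv w * ((((β * (L : ℝ) ^ 2 : ℝ) : ℂ) * (((1 / (β * (L : ℝ) ^ 2) : ℝ)) : ℂ)) *
          bgmGridSymbol L M (2 * (2 * M)) klE0 β μ K ω q₀ qv) := by rw [hunit, one_mul]
    _ = ((β * (L : ℝ) ^ 2 : ℝ) : ℂ) * (torusChar q₀ d * torusChar qv w *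
          ((((1 / (β * (L : ℝ) ^ 2) : ℝ)) : ℂ) * bgmGridSymbol L M (2 * (2 * M)) klE0 β μ K ω q₀ qv)) := by ring
    _ = _ := by rw [hp]

/-- **`T_X`, the first SPACE moment of the scale-`0` sector multiplier torus sum, as a number `≤ C·M/β`**: for `FrameOK R U N_sc μ K`,
`R.WF`, `|U| ≤ 1`, `μ ∈ klWindowC`, `(16/15)Gfr0|U| ≤ 1/50`, `2¹⁵ ≤ L`, `klBetaMin ≤ β`, `β³ ≤ M`, cutoff derivatives `≤ B` (orders `≤ 5`)
and a global derivative bound `W_A` of the angular factors `zoneAngularRaw 1 (1/4) 0 ω` (orders `≤ 3`): for every sector `ω` and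
orientation `c`,
`(|β|L²)⁻¹·Σ_{(d,w)} torusSiteDist(w,0)·‖Σ_k F_ω(k)Χ_c(k;d,w)‖ ≤ (8M/β)·(C₀'(B,W_A) + C₁'(B)·W_A·36864·S⁴·((N_sc+1)U² + 2|U|))`. -/
theorem spaceMoment_klAnisoFamily_zero_le [NeZero L] [NeZero M] {R : RenConsts} {U μ β : ℝ} {Nsc : ℕ} {K : TrigPolyC4v}
    (hK : FrameOK R U Nsc μ K) (hRwf : R.WF) (hU1 : |U| ≤ 1) (hμ : μ ∈ klWindowC) (hκU : 16 / 15 * (R.Gfr 0 * |U|) ≤ 1 / 50)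
    (hL : (2 : ℝ) ^ 15 ≤ L) (hβ : klBetaMin ≤ β) (hβM : β ^ 3 ≤ (M : ℝ)) {B : ℝ} (hB1 : 1 ≤ B)
    (hB : ∀ i ≤ 5, ∀ u, ‖iteratedDeriv i (bgmCutoffSqUnit klE0) u‖ ≤ B) {WA : ℝ} (hWA0 : 0 ≤ WA)
    (hWA : ∀ j ≤ 3, ∀ (ω : ℤ) (P : EuclideanSpace ℝ (Fin 2)), ‖iteratedFDeriv ℝ j (zoneAngularRaw 1 (1 / 4) 0 ω) P‖ ≤ WA)
    (ω : Fin (sectorCount 0)) (c : Fin 2) :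
    1 / (|β| * (L : ℝ) ^ 2) *
        ∑ dw : TorusSite 1 (2 * (2 * M)) × TorusSite 2 L,
          torusSiteDist dw.2 0 *
            ‖∑ k : FreqMomentum L M, klAnisoFamily L M β μ K klE0 0 ω k *
              (if c = 0 then torusChar (fun _ : Fin 1 => ((k.1 : ℕ) : ZMod (2 * (2 * M)))) dw.1 * torusChar k.2 dw.2
                else conj (torusChar (fun _ : Fin 1 => ((k.1 : ℕ) : ZMod (2 * (2 * M)))) dw.1 * torusChar k.2 dw.2))‖ ≤
      8 * (M : ℝ) / β *
        (uvSpaceMomentConst (2 * klE0) 1 (uvPieceSq (2 * klE0) (multAmp B klE0 4 (fun _ => WA) 0) (multAmp B klE0 4 (fun _ => WA) 1)) +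
        (1 / 4 * Real.sqrt (216 * (1 / (2 * klE0) + 1 / 2)) *
          ∑ e : Fin 2 × Fin 2, (uvLinV (2 * klE0) (1 + (e.1 : ℕ) + (e.2 : ℕ)) *
              (klE0 / 2 * (((1 + ((e.1 : ℕ) + (e.2 : ℕ)) + 1).factorial : ℝ) * B * (2 / klE0) ^ (1 + ((e.1 : ℕ) + (e.2 : ℕ)) + 1))) +
            uvLinD (2 * klE0) (1 + (e.1 : ℕ) + (e.2 : ℕ)) *
              (klE0 / 2 * (((1 + ((e.1 : ℕ) + (e.2 : ℕ)) + 2).factorial : ℝ) * B * (2 / klE0) ^ (1 + ((e.1 : ℕ) + (e.2 : ℕ)) + 2))))) *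
          (WA * (36864 * (1 + R.Gfr 0 + R.Gfr 1 + R.Gfr 2 + R.Gfr 3) ^ 4 * (((Nsc : ℝ) + 1) * U ^ 2 + 2 * |U|)))) := by
  classical
  haveI : NeZero (2 * (2 * M)) := ⟨by have := NeZero.ne M; omega⟩
  have hR0 : ∀ j, 0 ≤ R.Gfr j := hRwf.2.2
  have hβ2 : (2 : ℝ) ≤ β := le_trans (by norm_num [klBetaMin]) hβ
  have hβ0 : 0 < β := by linarith
  have hL0 : (0 : ℝ) < L := lt_of_lt_of_le (by norm_num) hL
  have hMN : 2 * M ≤ 2 * (2 * M) := by omega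
  have hNt : (((2 * (2 * M) : ℕ) : ℝ)) = 4 * M := by push_cast; ring
  have hNtpos : (0 : ℝ) < ((2 * (2 * M) : ℕ) : ℝ) := by
    rw [hNt]; have : (0 : ℝ) < M := by exact_mod_cast Nat.pos_of_ne_zero (NeZero.ne M)
    linarith
  have hA : ContDiff ℝ 3 (zoneAngularRaw 1 (1 / 4) 0 ((ω : ℕ) : ℤ)) := contDiff_zoneAngularRaw (by norm_num) 0 _
  have hWAω : ∀ j ≤ 3, ∀ x, ‖iteratedFDeriv ℝ j (zoneAngularRaw 1 (1 / 4) 0 ((ω : ℕ) : ℤ)) x‖ ≤ WA :=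
    fun j hj x => hWA j hj _ x
  -- reduce the conjugate orientation to the direct one and pass to the padded piece
  have hreal : ∀ (ω : Fin (sectorCount 0)) (k : FreqMomentum L M),
      conj ((fun ω k => klAnisoFamily L M β μ K klE0 0 ω k) ω k) = (fun ω k => klAnisoFamily L M β μ K klE0 0 ω k) ω k := by
    intro ω k; simp only [klAnisoFamily_zero_apply, Complex.conj_ofReal]
  have hc : ∀ dw : TorusSite 1 (2 * (2 * M)) × TorusSite 2 L, ‖∑ k : FreqMomentum L M, klAnisoFamily L M β μ K klE0 0 ω k *
      (if c = 0 then torusChar (fun _ : Fin 1 => ((k.1 : ℕ) : ZMod (2 * (2 * M)))) dw.1 * torusChar k.2 dw.2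
        else conj (torusChar (fun _ : Fin 1 => ((k.1 : ℕ) : ZMod (2 * (2 * M)))) dw.1 * torusChar k.2 dw.2))‖ =
      β * (L : ℝ) ^ 2 * ‖∑ q₀ : TorusSite 1 (2 * (2 * M)), ∑ qv : TorusSite 2 L, torusChar q₀ dw.1 * torusChar qv dw.2 *
        paddedPiece L M (2 * (2 * M)) β (fun ω' y => ((β * (L : ℝ) ^ 2 : ℝ) : ℂ) *
              (((bgmCutoff₂ klE0 (fbPt ω' (frameLevel μ K (WithLp.toLp 2 (torusCentredMomentum L y)))) : ℝ) : ℂ) *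
                ((zoneAngularRaw 1 (1 / 4) 0 ((ω : ℕ) : ℤ) (WithLp.toLp 2 (torusCentredMomentum L y)) : ℝ) : ℂ))) q₀ qv‖ := by
    intro dw
    have h0 : ‖∑ k : FreqMomentum L M, klAnisoFamily L M β μ K klE0 0 ω k *
        (if c = 0 then torusChar (fun _ : Fin 1 => ((k.1 : ℕ) : ZMod (2 * (2 * M)))) dw.1 * torusChar k.2 dw.2
          else conj (torusChar (fun _ : Fin 1 => ((k.1 : ℕ) : ZMod (2 * (2 * M)))) dw.1 * torusChar k.2 dw.2))‖ =
        ‖∑ k : FreqMomentum L M, klAnisoFamily L M β μ K klE0 0 ω k *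
          (torusChar (fun _ : Fin 1 => ((k.1 : ℕ) : ZMod (2 * (2 * M)))) dw.1 * torusChar k.2 dw.2)‖ := by
      by_cases hc0 : c = 0
      · simp only [hc0, if_true]
      · simp only [hc0, if_false]
        exact norm_charSum_conj_eq (fun ω k => klAnisoFamily L M β μ K klE0 0 ω k) hreal ω dw.1 dw.2
    rw [h0, charSum_klAnisoFamily_zero_eq_padded hK hR0 hμ hκU hβ0.ne' ω dw.1 dw.2, norm_mul, Complex.norm_real,
      Real.norm_of_nonneg (by positivity)]
  simp_rw [hc]
  -- the weight `torusSiteDist ≤ |b̃₀| + |b̃₁|` and the two directions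
  have hX : ∀ l : Fin 2, β / ((2 * (2 * M) : ℕ) : ℝ) * ∑ a : TorusSite 1 (2 * (2 * M)), ∑ bv : TorusSite 2 L,
      |(((bv l).valMinAbs : ℤ) : ℝ)| * ‖∑ q₀ : TorusSite 1 (2 * (2 * M)), ∑ qv : TorusSite 2 L, torusChar q₀ a * torusChar qv bv *
        paddedPiece L M (2 * (2 * M)) β (fun ω' y => ((β * (L : ℝ) ^ 2 : ℝ) : ℂ) *
              (((bgmCutoff₂ klE0 (fbPt ω' (frameLevel μ K (WithLp.toLp 2 (torusCentredMomentum L y)))) : ℝ) : ℂ) *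
                ((zoneAngularRaw 1 (1 / 4) 0 ((ω : ℕ) : ℤ) (WithLp.toLp 2 (torusCentredMomentum L y)) : ℝ) : ℂ))) q₀ qv‖ ≤
      (uvSpaceMomentConst (2 * klE0) 1 (uvPieceSq (2 * klE0) (multAmp B klE0 4 (fun _ => WA) 0) (multAmp B klE0 4 (fun _ => WA) 1)) +
        (1 / 4 * Real.sqrt (216 * (1 / (2 * klE0) + 1 / 2)) *
          ∑ e : Fin 2 × Fin 2, (uvLinV (2 * klE0) (1 + (e.1 : ℕ) + (e.2 : ℕ)) *
              (klE0 / 2 * (((1 + ((e.1 : ℕ) + (e.2 : ℕ)) + 1).factorial : ℝ) * B * (2 / klE0) ^ (1 + ((e.1 : ℕ) + (e.2 : ℕ)) + 1))) +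
            uvLinD (2 * klE0) (1 + (e.1 : ℕ) + (e.2 : ℕ)) *
              (klE0 / 2 * (((1 + ((e.1 : ℕ) + (e.2 : ℕ)) + 2).factorial : ℝ) * B * (2 / klE0) ^ (1 + ((e.1 : ℕ) + (e.2 : ℕ)) + 2))))) *
          (WA * (36864 * (1 + R.Gfr 0 + R.Gfr 1 + R.Gfr 2 + R.Gfr 3) ^ 4 * (((Nsc : ℝ) + 1) * U ^ 2 + 2 * |U|)))) := by
    intro l
    have hll' : l ≠ 1 - l := by fin_cases l <;> decide
    exact spaceMoment_multiplier_padded_le (L := L) (M := M) (N := 2 * (2 * M)) hK hRwf hU1 hμ hκU hL hβ2 hβM hMN hB1 hB hA hWA0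
      hWAω hll'
  -- assemble
  set S : TorusSite 1 (2 * (2 * M)) → TorusSite 2 L → ℝ := fun a bv => ‖∑ q₀ : TorusSite 1 (2 * (2 * M)), ∑ qv : TorusSite 2 L,
    torusChar q₀ a * torusChar qv bv * paddedPiece L M (2 * (2 * M)) β (fun ω' y => ((β * (L : ℝ) ^ 2 : ℝ) : ℂ) *
              (((bgmCutoff₂ klE0 (fbPt ω' (frameLevel μ K (WithLp.toLp 2 (torusCentredMomentum L y)))) : ℝ) : ℂ) *
                ((zoneAngularRaw 1 (1 / 4) 0 ((ω : ℕ) : ℤ) (WithLp.toLp 2 (torusCentredMomentum L y)) : ℝ) : ℂ))) q₀ qv‖ with hSdef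
  have hS0 : ∀ a bv, 0 ≤ S a bv := fun a bv => norm_nonneg _
  have hXv : 0 ≤ (uvSpaceMomentConst (2 * klE0) 1 (uvPieceSq (2 * klE0) (multAmp B klE0 4 (fun _ => WA) 0) (multAmp B klE0 4 (fun _ => WA) 1)) +
        (1 / 4 * Real.sqrt (216 * (1 / (2 * klE0) + 1 / 2)) *
          ∑ e : Fin 2 × Fin 2, (uvLinV (2 * klE0) (1 + (e.1 : ℕ) + (e.2 : ℕ)) *
              (klE0 / 2 * (((1 + ((e.1 : ℕ) + (e.2 : ℕ)) + 1).factorial : ℝ) * B * (2 / klE0) ^ (1 + ((e.1 : ℕ) + (e.2 : ℕ)) + 1))) +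
            uvLinD (2 * klE0) (1 + (e.1 : ℕ) + (e.2 : ℕ)) *
              (klE0 / 2 * (((1 + ((e.1 : ℕ) + (e.2 : ℕ)) + 2).factorial : ℝ) * B * (2 / klE0) ^ (1 + ((e.1 : ℕ) + (e.2 : ℕ)) + 2))))) *
          (WA * (36864 * (1 + R.Gfr 0 + R.Gfr 1 + R.Gfr 2 + R.Gfr 3) ^ 4 * (((Nsc : ℝ) + 1) * U ^ 2 + 2 * |U|)))) := by
    have h := hX 0
    refine le_trans ?_ h
    exact mul_nonneg (by positivity) (sum_nonneg fun a _ => sum_nonneg fun bv _ => mul_nonneg (abs_nonneg _) (hS0 a bv))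
  calc 1 / (|β| * (L : ℝ) ^ 2) * ∑ dw : TorusSite 1 (2 * (2 * M)) × TorusSite 2 L,
        torusSiteDist dw.2 0 * (β * (L : ℝ) ^ 2 * S dw.1 dw.2)
      = ∑ dw : TorusSite 1 (2 * (2 * M)) × TorusSite 2 L, torusSiteDist dw.2 0 * S dw.1 dw.2 := by
        rw [abs_of_pos hβ0, mul_sum]
        refine sum_congr rfl fun dw _ => ?_
        field_simp
    _ ≤ ∑ dw : TorusSite 1 (2 * (2 * M)) × TorusSite 2 L,
          (|(((dw.2 0).valMinAbs : ℤ) : ℝ)| + |(((dw.2 1).valMinAbs : ℤ) : ℝ)|) * S dw.1 dw.2 :=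
        sum_le_sum fun dw _ => mul_le_mul_of_nonneg_right (torusSiteDist_zero_le_abs_add_abs dw.2) (hS0 _ _)
    _ = (((2 * (2 * M) : ℕ) : ℝ)) / β *
          (β / ((2 * (2 * M) : ℕ) : ℝ) * ∑ a : TorusSite 1 (2 * (2 * M)), ∑ bv : TorusSite 2 L,
              |(((bv 0).valMinAbs : ℤ) : ℝ)| * S a bv +
            β / ((2 * (2 * M) : ℕ) : ℝ) * ∑ a : TorusSite 1 (2 * (2 * M)), ∑ bv : TorusSite 2 L,
              |(((bv 1).valMinAbs : ℤ) : ℝ)| * S a bv) := by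
        have hNβ : (((2 * (2 * M) : ℕ) : ℝ)) / β * (β / ((2 * (2 * M) : ℕ) : ℝ)) = 1 := by
          field_simp
        rw [mul_add, ← mul_assoc ((((2 * (2 * M) : ℕ) : ℝ)) / β) (β / ((2 * (2 * M) : ℕ) : ℝ)),
          ← mul_assoc ((((2 * (2 * M) : ℕ) : ℝ)) / β) (β / ((2 * (2 * M) : ℕ) : ℝ)), hNβ, one_mul, one_mul,
          Fintype.sum_prod_type, ← sum_add_distrib]
        refine sum_congr rfl fun a _ => ?_
        rw [← sum_add_distrib]
        refine sum_congr rfl fun bv _ => ?_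
        ring
    _ ≤ (((2 * (2 * M) : ℕ) : ℝ)) / β * ((uvSpaceMomentConst (2 * klE0) 1 (uvPieceSq (2 * klE0) (multAmp B klE0 4 (fun _ => WA) 0) (multAmp B klE0 4 (fun _ => WA) 1)) +
        (1 / 4 * Real.sqrt (216 * (1 / (2 * klE0) + 1 / 2)) *
          ∑ e : Fin 2 × Fin 2, (uvLinV (2 * klE0) (1 + (e.1 : ℕ) + (e.2 : ℕ)) *
              (klE0 / 2 * (((1 + ((e.1 : ℕ) + (e.2 : ℕ)) + 1).factorial : ℝ) * B * (2 / klE0) ^ (1 + ((e.1 : ℕ) + (e.2 : ℕ)) + 1))) +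
            uvLinD (2 * klE0) (1 + (e.1 : ℕ) + (e.2 : ℕ)) *
              (klE0 / 2 * (((1 + ((e.1 : ℕ) + (e.2 : ℕ)) + 2).factorial : ℝ) * B * (2 / klE0) ^ (1 + ((e.1 : ℕ) + (e.2 : ℕ)) + 2))))) *
          (WA * (36864 * (1 + R.Gfr 0 + R.Gfr 1 + R.Gfr 2 + R.Gfr 3) ^ 4 * (((Nsc : ℝ) + 1) * U ^ 2 + 2 * |U|)))) + (uvSpaceMomentConst (2 * klE0) 1 (uvPieceSq (2 * klE0) (multAmp B klE0 4 (fun _ => WA) 0) (multAmp B klE0 4 (fun _ => WA) 1)) +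
        (1 / 4 * Real.sqrt (216 * (1 / (2 * klE0) + 1 / 2)) *
          ∑ e : Fin 2 × Fin 2, (uvLinV (2 * klE0) (1 + (e.1 : ℕ) + (e.2 : ℕ)) *
              (klE0 / 2 * (((1 + ((e.1 : ℕ) + (e.2 : ℕ)) + 1).factorial : ℝ) * B * (2 / klE0) ^ (1 + ((e.1 : ℕ) + (e.2 : ℕ)) + 1))) +
            uvLinD (2 * klE0) (1 + (e.1 : ℕ) + (e.2 : ℕ)) *
              (klE0 / 2 * (((1 + ((e.1 : ℕ) + (e.2 : ℕ)) + 2).factorial : ℝ) * B * (2 / klE0) ^ (1 + ((e.1 : ℕ) + (e.2 : ℕ)) + 2))))) *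
          (WA * (36864 * (1 + R.Gfr 0 + R.Gfr 1 + R.Gfr 2 + R.Gfr 3) ^ 4 * (((Nsc : ℝ) + 1) * U ^ 2 + 2 * |U|))))) := by
        refine mul_le_mul_of_nonneg_left (add_le_add (hX 0) (hX 1)) (by positivity)
    _ = 8 * (M : ℝ) / β * (uvSpaceMomentConst (2 * klE0) 1 (uvPieceSq (2 * klE0) (multAmp B klE0 4 (fun _ => WA) 0) (multAmp B klE0 4 (fun _ => WA) 1)) +
        (1 / 4 * Real.sqrt (216 * (1 / (2 * klE0) + 1 / 2)) *
          ∑ e : Fin 2 × Fin 2, (uvLinV (2 * klE0) (1 + (e.1 : ℕ) + (e.2 : ℕ)) *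
              (klE0 / 2 * (((1 + ((e.1 : ℕ) + (e.2 : ℕ)) + 1).factorial : ℝ) * B * (2 / klE0) ^ (1 + ((e.1 : ℕ) + (e.2 : ℕ)) + 1))) +
            uvLinD (2 * klE0) (1 + (e.1 : ℕ) + (e.2 : ℕ)) *
              (klE0 / 2 * (((1 + ((e.1 : ℕ) + (e.2 : ℕ)) + 2).factorial : ℝ) * B * (2 / klE0) ^ (1 + ((e.1 : ℕ) + (e.2 : ℕ)) + 2))))) *
          (WA * (36864 * (1 + R.Gfr 0 + R.Gfr 1 + R.Gfr 2 + R.Gfr 3) ^ 4 * (((Nsc : ℝ) + 1) * U ^ 2 + 2 * |U|)))) := by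
        rw [hNt]; ring

end Summit.HubbardSuperconductivity.HubbardSuperconductivity.Theorems.EngineV8

end
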